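import Literature.NumberTheory.EllipticCurves.Rank1Residual.Typed.X10bHeegnerIndexCertificate
import Literature.NumberTheory.EllipticCurves.Miller2011.JetchevBoundIrreducible
import HarnessLib

/-!
# X10b, rank `0`, `3 ∣ #Ш_an` AND `3 ∣ c_q`: the Tamagawa-blocked resistant pairs — Miller 2011
# Thm. 5.4 (Jetchev's sharpening, Cha case) as the UPPER half, the `3`-descent as the LOWER half
# (cell `b2b-bsdres`, unit `b2b-bsdres-x10`, gen 7)

HONEST FRAMING (run/shared/lean/b2b/bsd-rank1-residual/, verbatim in every file): the goal of the
cell is to DELETE the COMBINATION-SHAPED residual classes of the Birch–Swinnerton-Dyer formula for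
ALL analytic-rank `≤ 1` elliptic curves over `ℚ` — "full BSD formula for every rank `≤ 1` curve in
class `C`" assembled STRICTLY from published theorems — so that the rank-`≤ 1` remainder becomes
exactly the CONSTRUCTION-SHAPED classes, which are TYPED (missing-input `Prop`s), NOT attempted.
This is not "finishing BSD". Theorems only (no definition, no new named fact); X10b stays
CONSTRUCTION-SHAPED as a class (referee R82.3); nothing is booked here; every pair closed through
this file carries the flag `Miller11-Thm54-Cha-case` of the named fact it consumes.

**What this file adds.** Unit x10b's `Typed/X10bHeegnerIndexCertificate.lean` closes, per pair, an
X10b rank-`0` pair with `ord_3 #Ш_an = 2` from Cha 2005 (UPPER: `ord_3 #Ш ≤ 2·ord_3 [E(K):ℤy_K]`)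
and the `3`-descent line `Sel^(3)(E/ℚ) ≠ 0` (LOWER, with Cassels–Tate), GIVEN the index certificate
`ord_3 [E(K) : ℤ y_K] ≤ 1`. By Gross–Zagier + BSD that certificate cannot exist when `3 ∣ c_q(E)` for
some bad prime `q` (the Tamagawa number inflates the index: `ord_3 I_K ≥ 1 + ord_3 ∏ c_q`; GJPST
2009 Rem. 3.13), and x10's two-engine census of the 22 RESISTANT classes `N < 5·10⁵`
(HOME/b2b-bsdres-x10/g6/heegidx/, X10-AUDIT.md §12.4) found exactly FOUR such Tamagawa-blocked
classes: `53966a1`, `129605x1`, `427130j1` (`ord_3 ∏c_q = 1`, `ord_3 I_K = 2` at the first Heegner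
field) and `340186p1` (`ord_3 ∏c_q = 2`, `ord_3 I_K = 3`). The printed lever there is Miller 2011
Thm. 5.4 = Jetchev's Tamagawa sharpening `ord_p #Ш(E/ℚ) ≤ 2·(ord_p I_K − max_q ord_p c_q)`, which
Miller states (and uses, for 3468h at `p = 5`) under Cha's hypotheses — IRREDUCIBLE `ρ̄_{E,p}`, not
surjective — i.e. exactly on X10b's Cartan-normaliser image; tree fact
`Miller2011.thm54_cha_padicValNat_shaOrder_add_tamagawa_le` (unit x9 gen 7, FLAG
`Miller11-Thm54-Cha-case`: Jetchev 2008 prints Cor. 1.5 under surjectivity; referee R83.3 / R2-20.1: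
bookable PUB with the mandatory flag). This file is its X10b consumer, the twin of the Cha file with
the index certificate relaxed to `ord_p [E(K) : ℤ y_K] ≤ k + ord_p c_q` at ONE prime `q ∣ N`:
* `missingUpperBoundAt_of_millerJetchev_of_index_le` — the typed UPPER half
  `ord_p #Ш ≤ ord_p #Ш_an` at a pair with `2k ≤ ord_p #Ш_an` (any analytic rank `≤ 1`, any odd `p`);
* `bsdp_of_millerJetchev_of_casselsTate_of_dvd` — plus the lower certificate `p^{2k-1} ∣ #Ш(E/ℚ)`
  and `ord_p #Ш_an = 2k` ⇒ `BSD(E,p)`; `padicValNat_shaOrder_eq_of_millerJetchev_of_casselsTate_of_dvd`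
  — `ord_p #Ш(E/ℚ) = 2k` EXACTLY;
* `bsdp_of_millerJetchev_of_casselsTate_of_selmerGroup_ne_bot` — rank `0`, `k = 1`, the descent's
  native line `Sel^(p)(E/ℚ) ≠ 0`;
* `bsdp_three_rankZero_of_millerJetchev_of_selmerThree_ne_bot` — the X10 instance at `p = 3` in the
  cell's canonical shape (`ClassX10 W 3`, `r_an = 0`), `padicValNat_shaOrder_eq_two_…` (the exact
  `3`-part `#Ш(E/ℚ)[3^∞] = 9`) and `missingInputAt_of_millerJetchev_of_selmerThree_ne_bot` (the typed
  missing input `X10.MissingInputAt W` of `Typed/X10.lean` DISCHARGED at such a pair).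
With `ord_p c_q = 0` (`w := 0`) every statement specialises to the Cha file's. Census instances
(X10-AUDIT.md §13; per-prime Tamagawa data job j085677, second engine j085682): `53966a1`
(`K = ℚ(√−79)`, `m = 36` on both engines), `129605x1` (`K = ℚ(√−19)`, `m = 36` on both engines),
`427130j1` (`K = ℚ(√−271)`, `m = 72`), each with `3 ∥ ∏c_q` carried by one prime, `#Ш_an = 9`,
`dim Sel₃ = 2` (x10b X10B-DESC3NS); `340186p1` (`∏c_q = 18`, `m = 108`) qualifies iff its `9`
sits at one prime (§13 records the split). Per curve; NOT a class theorem.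

References: Miller 2011 Thm. 5.4 / Thm. 5.2 / Def. 1.1 [Miller2011LMS]; Jetchev 2008 Cor. 1.5,
Rem. 6.2 [Jetchev2008]; Cha 2005 [Cha2005]; GJPST 2009 §3.5, Rem. 3.13 [GrigorovJorzaPatrikisSteinTarnita2009];
Cassels 1962 / Silverman AEC X.4.14 [SilvermanAEC2009]; cell files X10-AUDIT.md §12.4/§13,
HOME/b2b-bsdres-x10/g6/heegidx/README.md, X10B-DESC3NS.md §6, REFEREE.md R71.4/R82.3/R83.3.
-/

set_option autoImplicit false

noncomputable section

open scoped Classical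

open WeierstrassCurve Literature.NumberTheory.EllipticCurves
  Literature.NumberTheory.EllipticCurves.Rank1Residual
  Literature.NumberTheory.EllipticCurves.Rank1Residual.Typed
  Literature.NumberTheory.EllipticCurves.Miller2011

namespace Summit.BirchSwinnertonDyer.Rank1Residual.X10

section ClassFree

variable (W : WeierstrassCurve ℚ) [W.IsElliptic] [W.IsGloballyMinimal] (p : ℕ) [Fact p.Prime]
  {N : ℕ} [NeZero N] {K : Type} [Field K] [NumberField K]

/-- **The typed UPPER half from Miller's Thm. 5.4 (Jetchev–Cha) and a Tamagawa-inflated index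
certificate.** For a non-CM `E/ℚ` of analytic rank `≤ 1`, a Heegner field `K` (imaginary quadratic,
Heegner hypothesis for the level `N`, `p ∤ d_K`), a Heegner point `P = y_K` of infinite order, an
odd prime `p` with `p² ∤ N` and `E[p]` irreducible, and ONE prime `q ∣ N`: if
`ord_p [E(K) : ℤ P] ≤ k + ord_p c_q(E)` (per-curve certificate: the index, and the Tamagawa number at
`q`) and `#Ш(E/ℚ)_an` is a rational `s` with `2k ≤ ord_p s`, then `ord_p #Ш(E/ℚ) ≤ ord_p #Ш(E/ℚ)_an`
(`MissingUpperBoundAt W p`), by `ord_p #Ш(E/ℚ) ≤ 2·(ord_p [E(K):ℤP] − ord_p c_q)` (`hMJ`, FLAG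
`Miller11-Thm54-Cha-case`). With `ord_p c_q = 0` this is the Cha file's
`missingUpperBoundAt_of_cha_of_index_le`.
[cite: Miller2011LMS, Thm. 5.4 (arXiv:1010.2431 p. 11 L42–L50)] [cite: Jetchev2008, Cor. 1.5 (p. 3)] -/
theorem missingUpperBoundAt_of_millerJetchev_of_index_le
    (hMJ : thm54_cha_padicValNat_shaOrder_add_tamagawa_le)
    (hcm : ¬ W.HasCM) (hr : W.analyticRank ≤ 1) (hK : IsImaginaryQuadratic K)
    (hH : SatisfiesHeegnerHypothesis N K) {P : (W.baseChange K).toAffine.Point}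
    (hP : IsHeegnerPoint N W K P) (hnt : ¬ IsOfFinAddOrder P) (hp2 : p ≠ 2)
    (hpD : ¬ (p : ℤ) ∣ NumberField.discr K) (hpN : ¬ p ^ 2 ∣ N) (hirr : Irr W p)
    (q : ℕ) [Fact q.Prime] (hqN : q ∣ N) {k : ℕ}
    (hI : padicValNat p (AddSubgroup.zmultiples P).index ≤
      k + padicValNat p ((W.baseChange ℚ_[q]).localTamagawaNumber ℤ_[q]))
    {s : ℚ} (hs : shaAn W = (s : ℂ)) (hv : (2 * k : ℤ) ≤ padicValRat p s) :
    MissingUpperBoundAt W p := by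
  have hup : padicValNat p W.shaOrder ≤ 2 * (k + padicValNat p
      ((W.baseChange ℚ_[q]).localTamagawaNumber ℤ_[q]) -
      padicValNat p ((W.baseChange ℚ_[q]).localTamagawaNumber ℤ_[q])) :=
    padicValNat_shaOrder_le_of_index_sub_tamagawa hMJ W hK hH hP hnt p q hqN hcm hp2 hpD hpN hirr
      hr hI le_rfl
  have hup' : padicValNat p W.shaOrder ≤ 2 * k := by omega
  refine ⟨s, hs, le_trans ?_ hv⟩
  exact_mod_cast hup'

/-- **`BSD(E,p)` from the Jetchev–Cha upper bound and a lower certificate**, analytic rank `≤ 1`,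
odd `p`: granted Gross–Zagier–Kolyvagin (`hGZK`: `rank = r_an`, `Ш(E/ℚ)` finite), Cassels–Tate
(`hCT`: `#Ш` is a square) and Miller 2011 Thm. 5.4 under Cha's hypotheses (`hMJ`, FLAG
`Miller11-Thm54-Cha-case`), at a pair with `#Ш(E/ℚ)_an = s`, `ord_p s = 2k`, a Heegner field/point
and ONE prime `q ∣ N` with `ord_p [E(K) : ℤ y_K] ≤ k + ord_p c_q`, and the lower certificate
`p^{2k-1} ∣ #Ш(E/ℚ)` (e.g. `Ш(E)[p] ≠ 0` for `k = 1`), Miller's `BSD(E,p)` holds: the two typed halves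
`missingLowerBoundAt_of_casselsTate_of_pow_dvd` and
`missingUpperBoundAt_of_millerJetchev_of_index_le` meet. All three inputs are PUBLISHED statements;
the certificates are per-curve computations.
[cite: Miller2011LMS, Thm. 5.4 and Def. 1.1] [cite: SilvermanAEC2009, Thm. X.4.14] -/
theorem bsdp_of_millerJetchev_of_casselsTate_of_dvd
    (hGZK : rank_eq_analyticRank_of_analyticRank_le_one)
    (hCT : exists_casselsTate_pairing (K := ℚ))
    (hMJ : thm54_cha_padicValNat_shaOrder_add_tamagawa_le)
    (hcm : ¬ W.HasCM) (hr : W.analyticRank ≤ 1) (hK : IsImaginaryQuadratic K)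
    (hH : SatisfiesHeegnerHypothesis N K) {P : (W.baseChange K).toAffine.Point}
    (hP : IsHeegnerPoint N W K P) (hnt : ¬ IsOfFinAddOrder P) (hp2 : p ≠ 2)
    (hpD : ¬ (p : ℤ) ∣ NumberField.discr K) (hpN : ¬ p ^ 2 ∣ N) (hirr : Irr W p)
    (q : ℕ) [Fact q.Prime] (hqN : q ∣ N) {k : ℕ}
    (hI : padicValNat p (AddSubgroup.zmultiples P).index ≤
      k + padicValNat p ((W.baseChange ℚ_[q]).localTamagawaNumber ℤ_[q]))
    {s : ℚ} (hs : shaAn W = (s : ℂ)) (hv : padicValRat p s = 2 * k)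
    (hdvd : p ^ (2 * k - 1) ∣ W.shaOrder) : BSDp W p :=
  bsdp_of_missingPPartAt W p hGZK hr
    (missingPPartAt_of_lower_of_upper W p
      (missingLowerBoundAt_of_casselsTate_of_pow_dvd W p hCT (hGZK W hr).2 hs hv.le hdvd)
      (missingUpperBoundAt_of_millerJetchev_of_index_le W p hMJ hcm hr hK hH hP hnt hp2 hpD hpN hirr
        q hqN hI hs hv.symm.le))

/-- **The exact `p`-part under the same data: `ord_p #Ш(E/ℚ) = 2k`** (for `k = 1`: `#Ш(E/ℚ)[p^∞]`
has order exactly `p²`). Lower: Cassels–Tate squareness and `p^{2k-1} ∣ #Ш`; upper: Miller's Thm. 5.4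
(Jetchev–Cha) with the Tamagawa-inflated index certificate at one `q ∣ N`. No `#Ш_an` enters.
[cite: Miller2011LMS, Thm. 5.4] [cite: SilvermanAEC2009, Thm. X.4.14] -/
theorem padicValNat_shaOrder_eq_of_millerJetchev_of_casselsTate_of_dvd
    (hGZK : rank_eq_analyticRank_of_analyticRank_le_one)
    (hCT : exists_casselsTate_pairing (K := ℚ))
    (hMJ : thm54_cha_padicValNat_shaOrder_add_tamagawa_le)
    (hcm : ¬ W.HasCM) (hr : W.analyticRank ≤ 1) (hK : IsImaginaryQuadratic K)
    (hH : SatisfiesHeegnerHypothesis N K) {P : (W.baseChange K).toAffine.Point}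
    (hP : IsHeegnerPoint N W K P) (hnt : ¬ IsOfFinAddOrder P) (hp2 : p ≠ 2)
    (hpD : ¬ (p : ℤ) ∣ NumberField.discr K) (hpN : ¬ p ^ 2 ∣ N) (hirr : Irr W p)
    (q : ℕ) [Fact q.Prime] (hqN : q ∣ N) {k : ℕ}
    (hI : padicValNat p (AddSubgroup.zmultiples P).index ≤
      k + padicValNat p ((W.baseChange ℚ_[q]).localTamagawaNumber ℤ_[q]))
    (hdvd : p ^ (2 * k - 1) ∣ W.shaOrder) : padicValNat p W.shaOrder = 2 * k := by
  have hfin : W.ShaFinite := (hGZK W hr).2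
  have hsq : IsSquare W.shaOrder := isSquare_shaOrder_of_casselsTate hCT W hfin
  have hn : W.shaOrder ≠ 0 := (WeierstrassCurve.shaOrder_pos W hfin).ne'
  have hlow : 2 * k ≤ padicValNat p W.shaOrder :=
    two_mul_le_padicValNat_of_isSquare_of_pow_dvd hsq hn hdvd
  have hup : padicValNat p W.shaOrder ≤ 2 * (k + padicValNat p
      ((W.baseChange ℚ_[q]).localTamagawaNumber ℤ_[q]) -
      padicValNat p ((W.baseChange ℚ_[q]).localTamagawaNumber ℤ_[q])) :=
    padicValNat_shaOrder_le_of_index_sub_tamagawa hMJ W hK hH hP hnt p q hqN hcm hp2 hpD hpN hirr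
      hr hI le_rfl
  omega

/-- **Rank `0`, native descent line.** Granted GZK, Cassels–Tate and Miller 2011 Thm. 5.4 under Cha's
hypotheses (FLAG `Miller11-Thm54-Cha-case`): for a non-CM `E/ℚ` of analytic rank `0` with
`#Ш(E/ℚ)_an = s`, `ord_p s = 2`, `E[p]` irreducible, a Heegner field `K` (`p ∤ d_K`, `p² ∤ N`) and
Heegner point with the Tamagawa-inflated index certificate `ord_p [E(K) : ℤ y_K] ≤ 1 + ord_p c_q` at
ONE prime `q ∣ N`, and the `p`-descent line `Sel^(p)(E/ℚ) ≠ 0` (rank `0` by GZK and `p ∤ #E(ℚ)_tors`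
by irreducibility, so this IS `Ш(E)[p] ≠ 0`: `exists_sha_torsion_of_selmerGroup_ne_bot`), `BSD(E,p)`
holds and `#Ш(E/ℚ)[p^∞] = p²`. [cite: Miller2011LMS, Thm. 5.4 and Def. 1.1]
[cite: SilvermanAEC2009, Thm. X.4.14 and Thm. X.4.2 (a)] -/
theorem bsdp_of_millerJetchev_of_casselsTate_of_selmerGroup_ne_bot
    (hGZK : rank_eq_analyticRank_of_analyticRank_le_one)
    (hCT : exists_casselsTate_pairing (K := ℚ))
    (hMJ : thm54_cha_padicValNat_shaOrder_add_tamagawa_le)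
    (hcm : ¬ W.HasCM) (hr : W.analyticRank = 0) (hK : IsImaginaryQuadratic K)
    (hH : SatisfiesHeegnerHypothesis N K) {P : (W.baseChange K).toAffine.Point}
    (hP : IsHeegnerPoint N W K P) (hnt : ¬ IsOfFinAddOrder P) (hp2 : p ≠ 2)
    (hpD : ¬ (p : ℤ) ∣ NumberField.discr K) (hpN : ¬ p ^ 2 ∣ N) (hirr : Irr W p)
    (q : ℕ) [Fact q.Prime] (hqN : q ∣ N)
    (hI : padicValNat p (AddSubgroup.zmultiples P).index ≤
      1 + padicValNat p ((W.baseChange ℚ_[q]).localTamagawaNumber ℤ_[q]))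
    {s : ℚ} (hs : shaAn W = (s : ℂ)) (hv : padicValRat p s = 2)
    (hSel : W.selmerGroup (p : ℤ) ≠ ⊥) : BSDp W p := by
  have hr1 : W.analyticRank ≤ 1 := by omega
  have hrank : W.mordellWeilRank = 0 := by rw [(hGZK W hr1).1, hr]
  have htors : ¬ p ∣ W.torsionOrder := by
    intro hd
    have h0 := padicValNat_torsionOrder_eq_zero_of_irreducible W p hirr
    rw [padicValNat.eq_zero_iff] at h0
    rcases h0 with h | h | h
    · exact absurd h (Fact.out : p.Prime).one_lt.ne'
    · exact absurd h W.torsionOrder_pos_holds.ne'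
    · exact h hd
  have hdvd : p ∣ W.shaOrder :=
    dvd_shaOrder_of_exists_torsion W p
      (exists_sha_torsion_of_selmerGroup_ne_bot W p hSel hrank htors)
  exact bsdp_of_millerJetchev_of_casselsTate_of_dvd W p hGZK hCT hMJ hcm hr1 hK hH hP hnt hp2 hpD
    hpN hirr q hqN (k := 1) hI hs (by rw [hv]; norm_num) (by simpa using hdvd)

end ClassFree

/-! ### Class X10 at `p = 3`, rank `0`: the four Tamagawa-blocked RESISTANT classes -/

section X10

variable (W : WeierstrassCurve ℚ) [W.IsElliptic] [W.IsGloballyMinimal]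
  {N : ℕ} [NeZero N] {K : Type} [Field K] [NumberField K]

/-- **X10 ∧ `r = 0` ∧ `ord_3 #Ш_an = 2` ∧ `3 ∣ c_q`: `BSD(E,3)` from PUBLISHED statements plus two
finite certificates**, valid WITHOUT surjectivity of `ρ̄_{E,3}` (so on X10b). For a non-CM globally
minimal `E/ℚ` in class X10 (`p = 3` good ordinary, `E[3]` irreducible) of analytic rank `0` with
`#Ш(E/ℚ)_an = s`, `ord_3 s = 2`: given a Heegner field `K` (imaginary quadratic, Heegner hypothesis
for the level `N`, `3 ∤ d_K`, `9 ∤ N`) with Heegner point `P = y_K` of infinite order and ONE prime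
`q ∣ N` carrying the Tamagawa-inflated index certificate `ord_3 [E(K) : ℤ P] ≤ 1 + ord_3 c_q(E)`, and
the `3`-descent line `Sel^(3)(E/ℚ) ≠ 0`, Miller's `BSD(E,3)` holds. Named facts: GZK (`hGZK`),
Cassels–Tate (`hCT`), Miller 2011 Thm. 5.4 under Cha's hypotheses (`hMJ`, FLAG
`Miller11-Thm54-Cha-case`; `irr(3)` is in the class). Census: the four Tamagawa-blocked classes of
the X10b RESISTANT list `N < 5·10⁵` (`53966a1`, `129605x1`, `427130j1`; `340186p1` iff its `9 ∣ ∏c_q`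
sits at one prime), X10-AUDIT.md §13. Per curve; NOT a class theorem; the lane books the
certificates with the flag. [cite: Miller2011LMS, Thm. 5.4 and Def. 1.1]
[cite: SilvermanAEC2009, Thm. X.4.14] [cite: GrigorovJorzaPatrikisSteinTarnita2009, Rem. 3.13 (Tamagawa numbers divide the index)] -/
theorem bsdp_three_rankZero_of_millerJetchev_of_selmerThree_ne_bot
    (hGZK : rank_eq_analyticRank_of_analyticRank_le_one)
    (hCT : exists_casselsTate_pairing (K := ℚ))
    (hMJ : thm54_cha_padicValNat_shaOrder_add_tamagawa_le)
    (hX : ClassX10 W 3) (hcm : ¬ W.HasCM) (hr : W.analyticRank = 0)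
    (hK : IsImaginaryQuadratic K) (hH : SatisfiesHeegnerHypothesis N K)
    {P : (W.baseChange K).toAffine.Point} (hP : IsHeegnerPoint N W K P) (hnt : ¬ IsOfFinAddOrder P)
    (h3D : ¬ (3 : ℤ) ∣ NumberField.discr K) (h9N : ¬ 3 ^ 2 ∣ N)
    (q : ℕ) [Fact q.Prime] (hqN : q ∣ N)
    (hI : padicValNat 3 (AddSubgroup.zmultiples P).index ≤
      1 + padicValNat 3 ((W.baseChange ℚ_[q]).localTamagawaNumber ℤ_[q]))
    {s : ℚ} (hs : shaAn W = (s : ℂ)) (hv : padicValRat 3 s = 2)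
    (hSel : W.selmerGroup (3 : ℤ) ≠ ⊥) : BSDp W 3 :=
  bsdp_of_millerJetchev_of_casselsTate_of_selmerGroup_ne_bot W 3 hGZK hCT hMJ hcm hr hK hH hP hnt
    (by decide) h3D h9N hX.2.2.1 q hqN hI hs hv (by exact_mod_cast hSel)

/-- **The exact `3`-part on such a pair: `ord_3 #Ш(E/ℚ) = 2`**, i.e. `Ш(E/ℚ)[3^∞]` has order `9`
(the descent's `(ℤ/3)²` is all of it) — with the Tamagawa-inflated index certificate at one `q ∣ N`
in place of the Cha file's `ord_3 [E(K):ℤy_K] ≤ 1`. [cite: Miller2011LMS, Thm. 5.4]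
[cite: SilvermanAEC2009, Thm. X.4.14] -/
theorem padicValNat_shaOrder_eq_two_of_millerJetchev_of_selmerThree_ne_bot
    (hGZK : rank_eq_analyticRank_of_analyticRank_le_one)
    (hCT : exists_casselsTate_pairing (K := ℚ))
    (hMJ : thm54_cha_padicValNat_shaOrder_add_tamagawa_le)
    (hX : ClassX10 W 3) (hcm : ¬ W.HasCM) (hr : W.analyticRank = 0)
    (hK : IsImaginaryQuadratic K) (hH : SatisfiesHeegnerHypothesis N K)
    {P : (W.baseChange K).toAffine.Point} (hP : IsHeegnerPoint N W K P) (hnt : ¬ IsOfFinAddOrder P)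
    (h3D : ¬ (3 : ℤ) ∣ NumberField.discr K) (h9N : ¬ 3 ^ 2 ∣ N)
    (q : ℕ) [Fact q.Prime] (hqN : q ∣ N)
    (hI : padicValNat 3 (AddSubgroup.zmultiples P).index ≤
      1 + padicValNat 3 ((W.baseChange ℚ_[q]).localTamagawaNumber ℤ_[q]))
    (hSel : W.selmerGroup (3 : ℤ) ≠ ⊥) : padicValNat 3 W.shaOrder = 2 := by
  have hr1 : W.analyticRank ≤ 1 := by rw [hr]; norm_num
  have hrank : W.mordellWeilRank = 0 := by rw [(hGZK W hr1).1, hr]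
  have htors : ¬ 3 ∣ W.torsionOrder := by
    intro hd
    have h0 := padicValNat_torsionOrder_eq_zero_of_irreducible W 3 hX.2.2.1
    rw [padicValNat.eq_zero_iff] at h0
    rcases h0 with h | h | h
    · exact absurd h (by norm_num)
    · exact absurd h W.torsionOrder_pos_holds.ne'
    · exact h hd
  have hdvd : 3 ∣ W.shaOrder :=
    dvd_shaOrder_of_exists_torsion W 3
      (exists_sha_torsion_of_selmerGroup_ne_bot W 3 (by exact_mod_cast hSel) hrank htors)
  simpa using padicValNat_shaOrder_eq_of_millerJetchev_of_casselsTate_of_dvd W 3 hGZK hCT hMJ hcm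
    hr1 hK hH hP hnt (by decide) h3D h9N hX.2.2.1 q hqN (k := 1) hI (by simpa using hdvd)

/-- **Discharging the typed missing input of `Typed/X10.lean`** at such a pair: the data above give
`X10.MissingInputAt W` (`¬Surj W 3 → MissingPPartAt W 3`) — on a Tamagawa-blocked X10b RESISTANT pair
carrying the Jetchev-shape certificate nothing is missing. Per curve; bookkeeping.
[cite: Miller2011LMS, Thm. 5.4 and Def. 1.1] -/
theorem missingInputAt_of_millerJetchev_of_selmerThree_ne_bot
    (hGZK : rank_eq_analyticRank_of_analyticRank_le_one)
    (hCT : exists_casselsTate_pairing (K := ℚ))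
    (hMJ : thm54_cha_padicValNat_shaOrder_add_tamagawa_le)
    (hX : ClassX10 W 3) (hcm : ¬ W.HasCM) (hr : W.analyticRank = 0)
    (hK : IsImaginaryQuadratic K) (hH : SatisfiesHeegnerHypothesis N K)
    {P : (W.baseChange K).toAffine.Point} (hP : IsHeegnerPoint N W K P) (hnt : ¬ IsOfFinAddOrder P)
    (h3D : ¬ (3 : ℤ) ∣ NumberField.discr K) (h9N : ¬ 3 ^ 2 ∣ N)
    (q : ℕ) [Fact q.Prime] (hqN : q ∣ N)
    (hI : padicValNat 3 (AddSubgroup.zmultiples P).index ≤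
      1 + padicValNat 3 ((W.baseChange ℚ_[q]).localTamagawaNumber ℤ_[q]))
    {s : ℚ} (hs : shaAn W = (s : ℂ)) (hv : padicValRat 3 s = 2)
    (hSel : W.selmerGroup (3 : ℤ) ≠ ⊥) : Typed.X10.MissingInputAt W := fun _ =>
  haveI : Finite W.sha := (hGZK W hX.analyticRank_le_one).2
  missingPPartAt_of_bsdp W 3
    (bsdp_three_rankZero_of_millerJetchev_of_selmerThree_ne_bot W hGZK hCT hMJ hX hcm hr hK hH hP
      hnt h3D h9N q hqN hI hs hv hSel)

/-- **The Cha certificate is the `ord_3 c_q = 0` case.** If NO Tamagawa inflation is claimed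
(`ord_3 [E(K):ℤP] ≤ 1` outright), this file's rank-`0` X10 theorem applies with any prime `q ∣ N`
— so the Jetchev-shape certificate subsumes x10b's Cha-shape one on the RESISTANT list (the 18
classes with `3 ∤ ∏c_q` and the 4 Tamagawa-blocked ones are closed by ONE statement shape, modulo
the flag). Bookkeeping. [cite: Miller2011LMS, Thm. 5.4 and Thm. 5.2] -/
theorem bsdp_three_rankZero_of_millerJetchev_of_index_le_one_of_selmerThree_ne_bot
    (hGZK : rank_eq_analyticRank_of_analyticRank_le_one)
    (hCT : exists_casselsTate_pairing (K := ℚ))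
    (hMJ : thm54_cha_padicValNat_shaOrder_add_tamagawa_le)
    (hX : ClassX10 W 3) (hcm : ¬ W.HasCM) (hr : W.analyticRank = 0)
    (hK : IsImaginaryQuadratic K) (hH : SatisfiesHeegnerHypothesis N K)
    {P : (W.baseChange K).toAffine.Point} (hP : IsHeegnerPoint N W K P) (hnt : ¬ IsOfFinAddOrder P)
    (h3D : ¬ (3 : ℤ) ∣ NumberField.discr K) (h9N : ¬ 3 ^ 2 ∣ N)
    (q : ℕ) [Fact q.Prime] (hqN : q ∣ N)
    (hI : padicValNat 3 (AddSubgroup.zmultiples P).index ≤ 1)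
    {s : ℚ} (hs : shaAn W = (s : ℂ)) (hv : padicValRat 3 s = 2)
    (hSel : W.selmerGroup (3 : ℤ) ≠ ⊥) : BSDp W 3 :=
  bsdp_three_rankZero_of_millerJetchev_of_selmerThree_ne_bot W hGZK hCT hMJ hX hcm hr hK hH hP hnt
    h3D h9N q hqN (le_trans hI (Nat.le_add_right 1 _)) hs hv hSel

/-! ### Appended (gen 7, same session): the `ord_3 #Ш_an = 0` certificate case on class X10 — either rank -/

/-- **X10 ∧ `r ≤ 1` ∧ `ord_3 #Ш_an = 0` ∧ `3 ∣ c_q` at ONE prime: `Ш(E/ℚ)[3] = 0` from the Jetchev–Cha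
certificate case.** For a non-CM globally minimal `E/ℚ` in class X10 (`p = 3` good ordinary, `E[3]`
irreducible; `r_an ≤ 1` is in the class), a Heegner field `K` (`3 ∤ d_K`, `9 ∤ N`) with Heegner point
`P = y_K` of infinite order and ONE prime `q ∣ N` with `ord_3 [E(K) : ℤ P] ≤ ord_3 c_q(E)` (the
Tamagawa number absorbs the whole `3`-part of the index), Miller 2011 Thm. 5.4 under Cha's hypotheses
(`hMJ`, FLAG `Miller11-Thm54-Cha-case`) gives `ord_3 #Ш(E/ℚ) = 0`
(`Miller2011.padicValNat_shaOrder_eq_zero_of_index_le_tamagawa`), and with `Ш` finite (GZK) no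
non-zero class is killed by `3`. Census instance: **`308896be1 @ 3`** (rank `1`, image `3Nn`,
`#Ш_an = 1`, `c_197 = 3` at a split `I₃` — the single Tamagawa `3` —, `K = ℚ(√−47)`, index engines
`m = 48 / 48`, i.e. `ord_3 [E(K):ℤy_K] = 1 = ord_3 c_197`; X10-AUDIT.md §13.7): the ONE rank-`1` X10b
class `N < 5·10⁵` whose exact `3`-descent run did not return (X10B-DESC3NS.md §6.3, an engine
sampling failure) — this is its descent-free per-pair route. x9's `Rank1ResidualX9JetchevCha.lean`
has the same statement class-free (`noPTorsion_of_millerJetchev_of_index_le_tamagawa`); restated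
here over `ClassX10 W 3` without importing that module. Per curve; NOT a class theorem.
[cite: Miller2011LMS, Thm. 5.4 (arXiv:1010.2431 p. 11)] [cite: Jetchev2008, Cor. 1.5 (p. 3)] -/
theorem sha_noThreeTorsion_of_millerJetchev_of_index_le_tamagawa
    (hGZK : rank_eq_analyticRank_of_analyticRank_le_one)
    (hMJ : thm54_cha_padicValNat_shaOrder_add_tamagawa_le)
    (hX : ClassX10 W 3) (hcm : ¬ W.HasCM)
    (hK : IsImaginaryQuadratic K) (hH : SatisfiesHeegnerHypothesis N K)
    {P : (W.baseChange K).toAffine.Point} (hP : IsHeegnerPoint N W K P) (hnt : ¬ IsOfFinAddOrder P)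
    (h3D : ¬ (3 : ℤ) ∣ NumberField.discr K) (h9N : ¬ 3 ^ 2 ∣ N)
    (q : ℕ) [Fact q.Prime] (hqN : q ∣ N)
    (hI : padicValNat 3 (AddSubgroup.zmultiples P).index ≤
      padicValNat 3 ((W.baseChange ℚ_[q]).localTamagawaNumber ℤ_[q])) :
    ∀ x : W.sha, (3 : ℤ) • x = 0 → x = 0 := by
  have h0 : padicValNat 3 W.shaOrder = 0 :=
    padicValNat_shaOrder_eq_zero_of_index_le_tamagawa hMJ W hK hH hP hnt 3 q hqN hcm (by decide) h3D
      h9N hX.2.2.1 hX.analyticRank_le_one hI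
  exact_mod_cast Typed.noPTorsion_of_padicValNat_shaOrder_eq_zero W 3 (hGZK W hX.analyticRank_le_one).2 h0

/-- **… and `BSD(E,3)` at such a pair when `ord_3 #Ш_an = 0`** (`#Ш(E/ℚ)_an = s`, `ord_3 s = 0`):
both sides of Miller's last clause have valuation `0` (`Typed.bsdp_of_shaAn_unit_of_noPTorsion`).
Either analytic rank `≤ 1` (the class allows `r = 0 ∧ ¬ram(3)` and `r = 1 ∧ ¬sst`). Census instance
`308896be1 @ 3` (rank `1`; `#Ш_an = 1`): with this theorem the X10b rank-`1` census `N < 5·10⁵` is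
`487/487` per pair (486 by the flag-free exact descent, this one under the flag). Per curve; the lane
books the certificate with the flag. [cite: Miller2011LMS, Thm. 5.4 and Def. 1.1] -/
theorem bsdp_three_of_millerJetchev_of_index_le_tamagawa_of_shaAn_unit
    (hGZK : rank_eq_analyticRank_of_analyticRank_le_one)
    (hMJ : thm54_cha_padicValNat_shaOrder_add_tamagawa_le)
    (hX : ClassX10 W 3) (hcm : ¬ W.HasCM)
    (hK : IsImaginaryQuadratic K) (hH : SatisfiesHeegnerHypothesis N K)
    {P : (W.baseChange K).toAffine.Point} (hP : IsHeegnerPoint N W K P) (hnt : ¬ IsOfFinAddOrder P)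
    (h3D : ¬ (3 : ℤ) ∣ NumberField.discr K) (h9N : ¬ 3 ^ 2 ∣ N)
    (q : ℕ) [Fact q.Prime] (hqN : q ∣ N)
    (hI : padicValNat 3 (AddSubgroup.zmultiples P).index ≤
      padicValNat 3 ((W.baseChange ℚ_[q]).localTamagawaNumber ℤ_[q]))
    {s : ℚ} (hs : shaAn W = (s : ℂ)) (hv : padicValRat 3 s = 0) : BSDp W 3 :=
  Typed.bsdp_of_shaAn_unit_of_noPTorsion W 3 hGZK hX.analyticRank_le_one hs hv
    (sha_noThreeTorsion_of_millerJetchev_of_index_le_tamagawa W hGZK hMJ hX hcm hK hH hP hnt h3D h9N q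
      hqN hI)

/-- **… and the typed missing input of `Typed/X10.lean` is DISCHARGED there.** Bookkeeping.
[cite: Miller2011LMS, Thm. 5.4 and Def. 1.1] -/
theorem missingInputAt_of_millerJetchev_of_index_le_tamagawa_of_shaAn_unit
    (hGZK : rank_eq_analyticRank_of_analyticRank_le_one)
    (hMJ : thm54_cha_padicValNat_shaOrder_add_tamagawa_le)
    (hX : ClassX10 W 3) (hcm : ¬ W.HasCM)
    (hK : IsImaginaryQuadratic K) (hH : SatisfiesHeegnerHypothesis N K)
    {P : (W.baseChange K).toAffine.Point} (hP : IsHeegnerPoint N W K P) (hnt : ¬ IsOfFinAddOrder P)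
    (h3D : ¬ (3 : ℤ) ∣ NumberField.discr K) (h9N : ¬ 3 ^ 2 ∣ N)
    (q : ℕ) [Fact q.Prime] (hqN : q ∣ N)
    (hI : padicValNat 3 (AddSubgroup.zmultiples P).index ≤
      padicValNat 3 ((W.baseChange ℚ_[q]).localTamagawaNumber ℤ_[q]))
    {s : ℚ} (hs : shaAn W = (s : ℂ)) (hv : padicValRat 3 s = 0) : Typed.X10.MissingInputAt W := fun _ =>
  haveI : Finite W.sha := (hGZK W hX.analyticRank_le_one).2
  missingPPartAt_of_bsdp W 3
    (bsdp_three_of_millerJetchev_of_index_le_tamagawa_of_shaAn_unit W hGZK hMJ hX hcm hK hH hP hnt h3D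
      h9N q hqN hI hs hv)

end X10

end Summit.BirchSwinnertonDyer.Rank1Residual.X10

end
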